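import Literature.NumberTheory.EllipticCurves.ComplexMultiplicationShaProofs
import HarnessLib

/-!
# Deuring's `L(E_K/K, s) = L(E/ℚ, s)²` prime by prime: Euler products regrouped along `K/ℚ`

Sibling file of `Literature.NumberTheory.EllipticCurves.ComplexMultiplicationShaProofs` for its
named fact `Literature.NumberTheory.EllipticCurves.Deuring_LFunction_baseChange_cmField` —
Deuring's theorem (Silverman, *Advanced Topics in the Arithmetic of Elliptic Curves*, Ch. II,
Thm. 10.5 (a) and (b), PDF p. 171 of the held copy) in the Grössencharacter-free form it takes for
an elliptic curve `E/ℚ` with CM by the maximal order `𝓞_K` and `K` its CM field: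
`(W.baseChange K).LFunction = W.LFunction * W.LFunction` for Mathlib's formal Euler products
`WeierstrassCurve.LFunction`. This is the **second level of the decomposition** of that fact
(the first, `ComplexMultiplicationDeuringArtinProofs.lean`, goes through Artin formalism and
Knapp's Thm. 11.67, two general theorems that are themselves open named facts of the tree).
Here we follow the route of the printed source itself: Silverman proves Thm. 10.5(b) *prime by
prime* in Exercises 2.30–2.32 (PDF p. 179) — for a prime `𝔓` of `L` (here `L = ℚ`, `L' = LK = K`):

* (2.30) good reduction at `𝔓` ⇒ `𝔓` unramified in `L'`; if `𝔓 = 𝔓'𝔓''` splits,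
  `q_𝔓 = q_{𝔓'} = q_{𝔓''}` and `a_𝔓 = ψ(𝔓') + ψ(𝔓'')`; if `𝔓 = 𝔓'` is inert, `q_{𝔓'} = q_𝔓²`,
  `a_𝔓 = 0` and `ψ(𝔓') = -q_𝔓`;
* (2.31) `𝔓` ramified in `L'` ⇒ bad reduction at `𝔓`; `𝔓` unramified ⇒ (good at `𝔓` ⇔ good at
  `𝔓'`);
* (2.32)(a) `L_𝔓(E/L, T) = (1 - ψ(𝔓')T)(1 - ψ(𝔓'')T)`, `1 - ψ(𝔓')T'`, `1` in the three
  cases (in the inert case the printed variable is `T' = q_{𝔓'}^{-s} = T²`, `q_{𝔓'} = q_𝔓²`),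
  whence (b) `L(E/L, s) = L(s, ψ_{E/L'})` as an identity of Euler products, one prime of `L` at
  a time;

and Thm. 10.5(a) (proof, PDF p. 172) computes the factors of `L(E_K/K, s)` at the primes `𝔓'`
of `K`: `(1 - ψ(𝔓')T)(1 - ψ̄(𝔓')T)` at good `𝔓'`, `1` at bad `𝔓'` (where `ψ` is ramified,
Thm. 9.2(b)). Multiplying over the primes `𝔓' ∣ p` of `K` and comparing with the square of the
factor of `L(E/ℚ, s)` at `p` gives, for every rational prime `p`, the character-free local
identity

  `∏_{𝔓' ∣ p} L_{𝔓'}(E_K/K, q_{𝔓'}^{-s})⁻¹ = (L_p(E/ℚ, p^{-s})⁻¹)²`      (★ₚ)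

(split `p`: both sides `L_p(E, p^{-s})^{-2}` since `L_{𝔓'} = L_{𝔓''} = L_p`, the residue fields
being `𝔽_p` and `ψ(𝔓'') = ψ̄(𝔓')` for `E` defined over `ℚ`; inert `p`: `L_p(E,T) = 1 + pT²`
(`a_p = 0`, supersingular reduction) and `L_{𝔓'}(E_K, T') = (1 + pT')²` with `T' = T²`
(`a_{𝔓'} = -2p`); ramified or bad `p`: all factors `1`, CM curves having no multiplicative
reduction, *AEC* VII.5.5). This file

1. **proves** the Euler-product bookkeeping that turns the family of local identities (★ₚ) into
   the global one — in general, for Mathlib's formal `ArithmeticFunction.eulerProduct`: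
   regrouping an Euler product along a map with finite fibres
   (`ArithmeticFunction.eulerProduct_eq_eulerProduct_finprod_fiber`), the Euler product of a
   pointwise product (`ArithmeticFunction.eulerProduct_mul_eq`), hence for Weierstrass curves over
   number fields `F ⊆ K`: `L(X/K, s)` is the Euler product over the places `v` of `F` of
   `∏_{w ∣ v} L_w(X, q_w^{-s})⁻¹` (`WeierstrassCurve.LFunction_eq_eulerProduct_finprod_under`) and
   the **local-to-global principle** `WeierstrassCurve.LFunction_eq_mul_of_forall_finprod_eq_mul`:
   if `∏_{w ∣ v} L_w(X)⁻¹ = L_v(Y)⁻¹ · L_v(Z)⁻¹` for every `v` then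
   `X.LFunction = Y.LFunction * Z.LFunction` (the same lemma serves Artin formalism
   `WeierstrassCurve.LSeries_baseChange_quadratic` with `Y = W`, `Z = W^{(D)}`);
2. **vendors** (★ₚ), for all `p` at once, as the named fact
   `Deuring_localEulerFactor_baseChange_cmField` (Silverman's Exercises 2.30–2.32 with the proof
   of Thm. 10.5(a), character-free, stated for Mathlib's `WeierstrassCurve.localEulerFactor` on
   the completions — the factors of which `WeierstrassCurve.LFunction` is by definition the Euler
   product);
3. **proves** `Deuring_LFunction_baseChange_cmField_of_local`: (★ₚ) for all `p` implies
   `Deuring_LFunction_baseChange_cmField`.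

After this file the Deuring leaf of bsd.S28 rests on the per-prime statement (★ₚ), to be
discharged case by case (split / inert / ramified; the inert good case is Deuring's
supersingularity criterion `a_p = 0` together with `#Ẽ(𝔽_{p²}) = (p + 1)²`, cf. Exercise 2.33(a)
for `y² = x³ - Dx`).

## Faithfulness

(★ₚ) is implied by the printed statements exactly as the global fact is (see the docstring of
`Deuring_LFunction_baseChange_cmField`): Exercise 2.32(a) and the proof of Thm. 10.5(a) give both
sides of (★ₚ) in terms of `ψ = ψ_{E/K}`, and at a split `p` one has `ψ(𝔓'') = ψ̄(𝔓')` because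
`L(s, ψ) = L(E/ℚ, s)` (2.32(b)) has integer Dirichlet coefficients, so that `L(s, ψ̄) = L(s, ψ)`
Euler factor by Euler factor (the factor of `L(s, ψ̄)` at `p` is `(1 - ψ̄(𝔓')T)(1 - ψ̄(𝔓'')T)`).
It is not stronger than the sources and, through `LFunction_eq_eulerProduct_finprod_under`, it
refines the global fact prime by prime (the global identity is the Euler product of the local
ones). The hypotheses (`W.j ∈ maximalCMJInvariants`, `IsCMFieldOfJ K W.j`) are those of the
global fact, verbatim; `K : Type` as there.

## References

* J. H. Silverman, *Advanced Topics in the Arithmetic of Elliptic Curves*, GTM 151 (1994), Ch. II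
  §10: definition of `L_𝔓(E/L, T)` and `L(E/L, s)` (PDF p. 168), Prop. 10.4 and Cor. 10.4.1
  (pp. 170–171), Thm. 10.5 (p. 171) and its proof (p. 172), Exercises 2.30–2.33 (p. 179).
  [SilvermanATAEC1994]
* J. H. Silverman, *The Arithmetic of Elliptic Curves*, 2nd ed. (2009), VII.5.4(b), VII.5.5,
  §C.16. [SilvermanAEC2009]
-/

noncomputable section

open scoped Classical

open Filter

/-! ### Euler products: regrouping along finite fibres, and pointwise products -/

namespace ArithmeticFunction

variable {ι κ R : Type*} [CommSemiring R]

/-- If every factor `f i`, `i ∈ s`, agrees with `1` in all coefficients `≤ n`, so does the finite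
product `∏ i ∈ s, f i` (the `m`-th coefficient of a Dirichlet convolution only involves
coefficients of index `≤ m`). [folklore] -/
theorem finsetProd_apply_eq_one_apply_of_le (s : Finset ι) (f : ι → ArithmeticFunction R) {n : ℕ}
    (h : ∀ i ∈ s, ∀ m ≤ n, f i m = (1 : ArithmeticFunction R) m) :
    ∀ m ≤ n, (∏ i ∈ s, f i) m = (1 : ArithmeticFunction R) m := by
  classical
  induction s using Finset.induction_on with
  | empty => intro m _; rw [Finset.prod_empty]
  | insert i s hi ih =>
    intro m hm
    rw [Finset.prod_insert hi, ← one_mul (1 : ArithmeticFunction R), mul_apply, mul_apply]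
    refine Finset.sum_congr rfl fun x hx ↦ ?_
    have hx1 : x.1 ≤ m := Nat.divisor_le (Nat.fst_mem_divisors_of_mem_antidiagonal hx)
    have hx2 : x.2 ≤ m := Nat.divisor_le (Nat.snd_mem_divisors_of_mem_antidiagonal hx)
    rw [h i (Finset.mem_insert_self i s) x.1 (hx1.trans hm),
      ih (fun j hj ↦ h j (Finset.mem_insert_of_mem hj)) x.2 (hx2.trans hm)]

/-- For a family converging to `1` coefficientwise along the cofinite filter (the hypothesis of
`tendsTo_eulerProduct_of_tendsTo`), only finitely many members disagree with `1` in some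
coefficient of index `≤ n`. [folklore] -/
theorem finite_setOf_exists_apply_ne_one (f : ι → ArithmeticFunction R)
    (hf : ∀ n, ∀ᶠ i in cofinite, f i n = (1 : ArithmeticFunction R) n) (n : ℕ) :
    {i | ∃ m ≤ n, f i m ≠ (1 : ArithmeticFunction R) m}.Finite := by
  refine ((Set.finite_Iic n).biUnion fun m _ ↦ (hf m)).subset fun i hi ↦ ?_
  obtain ⟨m, hm, him⟩ := hi
  exact Set.mem_biUnion (Set.mem_Iic.mpr hm) him

/-- **Regrouping an Euler product along finite fibres.** Let `f : ι → ArithmeticFunction R`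
converge to `1` coefficientwise along the cofinite filter and let `π : ι → κ` have finite fibres.
Then the Euler product of `f` is the Euler product, over `k : κ`, of the finite products
`∏_{π i = k} f i` — e.g. the Euler product over the primes `𝔓` of a number field `K` is the Euler
product over the rational primes `p` of `∏_{𝔓 ∣ p}`. (Both sides are limits of finite partial
products, `tendsTo_eulerProduct_of_tendsTo`; a partial product over a union of whole fibres is a
partial product of fibre products.) [folklore] -/
theorem eulerProduct_eq_eulerProduct_finprod_fiber (f : ι → ArithmeticFunction R) (π : ι → κ)
    (hfib : ∀ k, {i | π i = k}.Finite)
    (hf : ∀ n, ∀ᶠ i in cofinite, f i n = (1 : ArithmeticFunction R) n) :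
    eulerProduct f = eulerProduct fun k ↦ ∏ᶠ i ∈ {i | π i = k}, f i := by
  classical
  set F : κ → ArithmeticFunction R := fun k ↦ ∏ᶠ i ∈ {i | π i = k}, f i with hF_def
  have hFk : ∀ k, F k = ∏ i ∈ (hfib k).toFinset, f i := fun k ↦
    finprod_mem_eq_finite_toFinset_prod _ (hfib k)
  -- the regrouped family converges to `1` coefficientwise as well
  have hF : ∀ n, ∀ᶠ k in cofinite, F k n = (1 : ArithmeticFunction R) n := by
    intro n
    have hB := finite_setOf_exists_apply_ne_one f hf n
    rw [eventually_cofinite]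
    refine (hB.image π).subset fun k hk ↦ ?_
    by_contra hk'
    apply hk
    rw [hFk]
    refine finsetProd_apply_eq_one_apply_of_le _ _ (fun i hi m hm ↦ ?_) n le_rfl
    by_contra him
    exact hk' ⟨i, ⟨m, hm, him⟩, (hfib k).mem_toFinset.mp hi⟩
  ext n
  obtain ⟨t₀, ht₀⟩ := eventually_atTop.mp (tendsTo_eulerProduct_of_tendsTo f hf n)
  obtain ⟨s₀, hs₀⟩ := eventually_atTop.mp (tendsTo_eulerProduct_of_tendsTo F hF n)
  set s : Finset κ := s₀ ∪ t₀.image π with hs_def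
  set t : Finset ι := s.biUnion fun k ↦ (hfib k).toFinset with ht_def
  have ht : t₀ ≤ t := fun i hi ↦ Finset.mem_biUnion.mpr
    ⟨π i, Finset.mem_union_right _ (Finset.mem_image_of_mem π hi), (hfib _).mem_toFinset.mpr rfl⟩
  have hdisj : (↑s : Set κ).PairwiseDisjoint fun k ↦ (hfib k).toFinset := by
    intro k₁ _ k₂ _ hne
    simp only [Function.onFun]
    rw [Finset.disjoint_left]
    intro i h1 h2
    rw [Set.Finite.mem_toFinset, Set.mem_setOf_eq] at h1 h2
    exact hne (h1.symm.trans h2)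
  have hprod : ∏ i ∈ t, f i = ∏ k ∈ s, F k := by
    rw [ht_def, Finset.prod_biUnion hdisj]
    exact Finset.prod_congr rfl fun k _ ↦ (hFk k).symm
  rw [← ht₀ t ht, hprod, hs₀ s Finset.subset_union_left]

/-- **The Euler product of a pointwise product** of two families converging to `1`
coefficientwise is the product of their Euler products. [folklore] -/
theorem eulerProduct_mul_eq (f g : ι → ArithmeticFunction R)
    (hf : ∀ n, ∀ᶠ i in cofinite, f i n = (1 : ArithmeticFunction R) n)
    (hg : ∀ n, ∀ᶠ i in cofinite, g i n = (1 : ArithmeticFunction R) n) :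
    eulerProduct (fun i ↦ f i * g i) = eulerProduct f * eulerProduct g := by
  classical
  -- the pointwise product converges to `1` coefficientwise
  have hfg : ∀ n, ∀ᶠ i in cofinite, (f i * g i) n = (1 : ArithmeticFunction R) n := by
    intro n
    have hB := (finite_setOf_exists_apply_ne_one f hf n).union
      (finite_setOf_exists_apply_ne_one g hg n)
    rw [eventually_cofinite]
    refine hB.subset fun i hi ↦ ?_
    by_contra hi'
    simp only [Set.mem_union, Set.mem_setOf_eq, not_or, not_exists, not_and, not_not] at hi'
    apply hi
    rw [← one_mul (1 : ArithmeticFunction R), mul_apply, mul_apply]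
    refine Finset.sum_congr rfl fun x hx ↦ ?_
    rw [hi'.1 x.1 (Nat.divisor_le (Nat.fst_mem_divisors_of_mem_antidiagonal hx)),
      hi'.2 x.2 (Nat.divisor_le (Nat.snd_mem_divisors_of_mem_antidiagonal hx))]
  ext n
  -- partial products computing all coefficients of index `≤ n` of the three Euler products
  have hf' : ∀ᶠ s : Finset ι in atTop, ∀ m ∈ Finset.range (n + 1),
      (∏ i ∈ s, f i) m = eulerProduct f m :=
    (eventually_all_finset _).mpr fun m _ ↦ tendsTo_eulerProduct_of_tendsTo f hf m
  have hg' : ∀ᶠ s : Finset ι in atTop, ∀ m ∈ Finset.range (n + 1),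
      (∏ i ∈ s, g i) m = eulerProduct g m :=
    (eventually_all_finset _).mpr fun m _ ↦ tendsTo_eulerProduct_of_tendsTo g hg m
  obtain ⟨s, ⟨hsf, hsg⟩, hs⟩ :=
    ((hf'.and hg').and (tendsTo_eulerProduct_of_tendsTo _ hfg n)).exists
  rw [← hs, Finset.prod_mul_distrib, mul_apply, mul_apply]
  refine Finset.sum_congr rfl fun x hx ↦ ?_
  have hx1 : x.1 ≤ n := Nat.divisor_le (Nat.fst_mem_divisors_of_mem_antidiagonal hx)
  have hx2 : x.2 ≤ n := Nat.divisor_le (Nat.snd_mem_divisors_of_mem_antidiagonal hx)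
  rw [hsf x.1 (Finset.mem_range.mpr (by omega)), hsg x.2 (Finset.mem_range.mpr (by omega))]

end ArithmeticFunction

/-! ### `L(X/K, s)` regrouped over the places of a subfield; the local-to-global principle -/

namespace IsDedekindDomain.HeightOneSpectrum

open NumberField

/-- The finite places of a number field `K` above a finite place `v` of a subfield `F` (the
fibre of `w ↦ w ∩ 𝓞 F`, Mathlib's `HeightOneSpectrum.under`) form a finite set: they inject into
the primes of `𝓞 K` over `v` (`IsDedekindDomain.primesOver_finite`). (The tree has this under
heavier imports, `Literature.NumberTheory.GaloisRepresentations.finite_setOf_under_eq`; restated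
here to keep this file light.) [folklore] -/
theorem finite_setOf_under_eq_of_numberField {F K : Type*} [Field F] [NumberField F] [Field K]
    [NumberField K] [Algebra F K] (v : HeightOneSpectrum (𝓞 F)) :
    {w : HeightOneSpectrum (𝓞 K) | w.under (𝓞 F) = v}.Finite := by
  have hfin := IsDedekindDomain.primesOver_finite v.asIdeal (𝓞 K)
  refine (hfin.preimage (f := fun w : HeightOneSpectrum (𝓞 K) ↦ w.asIdeal)
    fun _ _ _ _ h ↦ HeightOneSpectrum.ext h).subset fun w hw ↦ ?_
  refine ⟨w.isPrime, ⟨?_⟩⟩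
  rw [Set.mem_setOf_eq] at hw
  rw [← hw]
  rfl

end IsDedekindDomain.HeightOneSpectrum

namespace WeierstrassCurve

open ArithmeticFunction IsDedekindDomain NumberField

variable (F : Type*) {K : Type*} [Field F] [NumberField F] [Field K] [NumberField K] [Algebra F K]

/-- **`L(X/K, s)` as an Euler product over the places of a subfield.** For a Weierstrass curve
`X` over a number field `K ⊇ F`, Mathlib's `X.LFunction = ∏_w L_w(X, q_w^{-s})⁻¹` (over the finite
places `w` of `K`) is the Euler product over the finite places `v` of `F` of the finite products
`∏_{w ∣ v} L_w(X, q_w^{-s})⁻¹` — the grouping "one rational prime at a time" of Silverman,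
*Advanced Topics*, Exercise 2.32, and of Artin formalism. [folklore] -/
theorem LFunction_eq_eulerProduct_finprod_under (X : WeierstrassCurve K) :
    X.LFunction = eulerProduct fun v : HeightOneSpectrum (𝓞 F) ↦
      ∏ᶠ w ∈ {w : HeightOneSpectrum (𝓞 K) | w.under (𝓞 F) = v},
        (X.baseChange (w.adicCompletion K)).localEulerFactor (w.adicCompletionIntegers K) := by
  rw [LFunction_eq_eulerProduct]
  exact eulerProduct_eq_eulerProduct_finprod_fiber _ (fun w ↦ w.under (𝓞 F))
    (fun v ↦ v.finite_setOf_under_eq_of_numberField) X.eventually_cofinite_localEulerFactor_apply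

/-- **Local-to-global principle for products of `L`-functions.** Let `X` be a Weierstrass curve
over a number field `K ⊇ F` and `Y, Z` Weierstrass curves over `F`. If for every finite place
`v` of `F` the product of the local Euler factors of `X` at the places `w ∣ v` of `K` is the
product of the local Euler factors of `Y` and `Z` at `v` (as formal Dirichlet series in the
powers of `p_v`), then `L(X/K, s) = L(Y/F, s) · L(Z/F, s)` as formal Dirichlet series. With
`X = W_K`, `Y = Z = W` this assembles Deuring's theorem (Silverman, *Advanced Topics*, Ex. 2.32(b)
from 2.32(a)); with `Y = W`, `Z = W^{(D)}` it assembles Artin formalism for a quadratic field.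
[folklore] -/
theorem LFunction_eq_mul_of_forall_finprod_eq_mul (X : WeierstrassCurve K) (Y Z : WeierstrassCurve F)
    (h : ∀ v : HeightOneSpectrum (𝓞 F),
      ∏ᶠ w ∈ {w : HeightOneSpectrum (𝓞 K) | w.under (𝓞 F) = v},
          (X.baseChange (w.adicCompletion K)).localEulerFactor (w.adicCompletionIntegers K) =
        (Y.baseChange (v.adicCompletion F)).localEulerFactor (v.adicCompletionIntegers F) *
          (Z.baseChange (v.adicCompletion F)).localEulerFactor (v.adicCompletionIntegers F)) :
    X.LFunction = Y.LFunction * Z.LFunction := by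
  have hfun : (fun v : HeightOneSpectrum (𝓞 F) ↦
      ∏ᶠ w ∈ {w : HeightOneSpectrum (𝓞 K) | w.under (𝓞 F) = v},
        (X.baseChange (w.adicCompletion K)).localEulerFactor (w.adicCompletionIntegers K)) =
      fun v ↦ (Y.baseChange (v.adicCompletion F)).localEulerFactor (v.adicCompletionIntegers F) *
        (Z.baseChange (v.adicCompletion F)).localEulerFactor (v.adicCompletionIntegers F) :=
    funext h
  rw [X.LFunction_eq_eulerProduct_finprod_under F, hfun, Y.LFunction_eq_eulerProduct,
    Z.LFunction_eq_eulerProduct]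
  exact eulerProduct_mul_eq _ _ Y.eventually_cofinite_localEulerFactor_apply
    Z.eventually_cofinite_localEulerFactor_apply

end WeierstrassCurve

/-! ### Deuring's theorem prime by prime -/

namespace Literature.NumberTheory.EllipticCurves

open WeierstrassCurve IsDedekindDomain NumberField

/-- **Deuring's theorem, one rational prime at a time** (Silverman, *Advanced Topics*, Ch. II,
Exercises 2.30–2.32 — the printed prime-by-prime proof of Thm. 10.5(b) — together with the proof
of Thm. 10.5(a), PDF pp. 172 and 179, in character-free form). Let `E = W/ℚ` be an elliptic curve
with CM by the maximal order `𝓞_K` (`W.j ∈ maximalCMJInvariants`) and `K` its CM field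
(`IsCMFieldOfJ K W.j`, `K ≅ ℚ(√d_K)`); let `p` be a rational prime (a finite place `v` of `ℚ`)
and `𝔓' ∣ p` the primes of `K` above it (the places `w` of `K` with `w ∩ ℤ = v`). Printed
statements, with `ψ = ψ_{E/K}` the Grössencharacter of `E_K/K` and `L' = K`:
*(2.32(a))* `L_p(E/ℚ, T) = (1 - ψ(𝔓')T)(1 - ψ(𝔓'')T)` if `p = 𝔓'𝔓''` splits in `K`,
`= 1 - ψ(𝔓')T'` with `T' = T²` [`q_{𝔓'} = p²`; (2.30(c)): `ψ(𝔓') = -p`, `a_p = 0`] if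
`p = 𝔓'` is inert,
`= 1` if `p = 𝔓'²` ramifies [(2.31(a)): bad reduction]; *(proof of 10.5(a))*
`L_{𝔓'}(E_K/K, T) = (1 - ψ(𝔓')T)(1 - ψ̄(𝔓')T)` at a prime of good reduction and `= 1` at a prime
of bad reduction of `E_K`, where `ψ(𝔓') = 0` (ψ ramified, Thm. 9.2(b)). Since
`L(s, ψ) = L(E/ℚ, s)` (2.32(b)) has integer Dirichlet coefficients, `ψ(𝔓'') = ψ̄(𝔓')` at split
`p`, and multiplying the factors of `E_K` over `𝔓' ∣ p` gives, in every case,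
`∏_{𝔓' ∣ p} L_{𝔓'}(E_K/K, q_{𝔓'}^{-s})⁻¹ = (L_p(E/ℚ, p^{-s})⁻¹)²` as Dirichlet series supported on
the powers of `p`: split, `L_{𝔓'} = L_{𝔓''} = L_p`; inert, `(1 + pT')⁻²` at `T' = T²` against
`((1 + pT²)⁻¹)²`; ramified or bad, `1 = 1²` (no multiplicative reduction, *AEC* VII.5.5). In the
tree's vocabulary both sides are Mathlib's `WeierstrassCurve.localEulerFactor`
(`= ofPowerSeries q_w (L_w(T)⁻¹)`, computed on a minimal model over the completion), the factors
of which `WeierstrassCurve.LFunction` is by definition the Euler product; the global identity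
`Deuring_LFunction_baseChange_cmField` follows by `Deuring_LFunction_baseChange_cmField_of_local`.
[cite: SilvermanATAEC1994, Ch. II Exercises 2.30–2.32 (PDF p. 179) with Thm. 10.5 (a) and its proof (PDF pp. 171–172)] -/
def Deuring_localEulerFactor_baseChange_cmField : Prop :=
  ∀ (W : WeierstrassCurve ℚ) [W.IsElliptic], W.j ∈ maximalCMJInvariants →
    ∀ (K : Type) [Field K] [NumberField K], IsCMFieldOfJ K W.j →
      ∀ v : HeightOneSpectrum (𝓞 ℚ),
        ∏ᶠ w ∈ {w : HeightOneSpectrum (𝓞 K) | w.under (𝓞 ℚ) = v},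
            ((W.baseChange K).baseChange (w.adicCompletion K)).localEulerFactor
              (w.adicCompletionIntegers K) =
          (W.baseChange (v.adicCompletion ℚ)).localEulerFactor (v.adicCompletionIntegers ℚ) ^ 2

/-- **Deuring's `L(E_K/K, s) = L(E/ℚ, s)²` from its prime-by-prime form** (Silverman, *Advanced
Topics*, Ex. 2.32(b) from 2.32(a): the global identity is the product of the local ones). Given
`Deuring_localEulerFactor_baseChange_cmField` (★ₚ for every `p`), the Euler product of `E_K` over
the primes of `K`, regrouped over the rational primes
(`WeierstrassCurve.LFunction_eq_eulerProduct_finprod_under`), is the Euler product of the squares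
of the factors of `E/ℚ`, i.e. `W.LFunction * W.LFunction`
(`WeierstrassCurve.LFunction_eq_mul_of_forall_finprod_eq_mul`).
[cite: SilvermanATAEC1994, Ch. II Thm. 10.5 (a), (b) and Exercise 2.32 (PDF pp. 171, 179)] -/
theorem Deuring_LFunction_baseChange_cmField_of_local
    (h : Deuring_localEulerFactor_baseChange_cmField) : Deuring_LFunction_baseChange_cmField := by
  intro W _ hj K _ _ hK
  exact LFunction_eq_mul_of_forall_finprod_eq_mul ℚ (W.baseChange K) W W fun v ↦ by
    rw [h W hj K hK v, sq]

end Literature.NumberTheory.EllipticCurves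

end
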